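import Literature.CategoryTheory.Abelian.FittingLemmaBichain
import Literature.CategoryTheory.Abelian.BichainConditionFiniteLength
import Literature.CategoryTheory.Preadditive.KrullSchmidtSummands
import Literature.CategoryTheory.Preadditive.KrullSchmidtObjects
import Literature.CategoryTheory.Preadditive.KrullSchmidtUniqueness
import Mathlib.Logic.Equiv.Fin.Basic
import HarnessLib

/-!
# Atiyah's Krull–Schmidt theorem: objects satisfying the bi-chain condition (in particular objects of finite length of an abelian
# category) have Remak decompositions, unique up to isomorphism (Atiyah 1956, Lemma 4 and Theorem 1; Krause 2015, Theorem 5.5)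

Topic `Literature/CategoryTheory/Abelian`, namespace `Literature.CategoryTheory.KrullSchmidt`.  Fourth file of the CHAIN-CONDITIONS story
(g41-#1 `Preadditive/BichainCondition`, g41-#2 `Abelian/BichainConditionFiniteLength`, g41-#3 `Abelian/FittingLemmaBichain`), closing it:
existence of decompositions into indecomposables for bi-chain objects (Atiyah's Lemma 4, in any preadditive category with finite
biproducts), local endomorphism rings of the summands and Krull–Remak–Schmidt uniqueness in abelian categories (Krause's Thm. 5.5,
Atiyah's Theorem 1), and the corollaries for objects of finite length and for abelian categories with both chain conditions.  Theorems
only, 0 `sorry`, no definition, no named fact (net debt 0), no instance, no notation.  Decompositions are phrased as in the tree's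
Krull–Schmidt files: `∃ (n : ℕ) (Z : Fin n → C), Nonempty (X ≅ ⨁ Z) ∧ ∀ j, Indecomposable (Z j)` (Atiyah's «Remak decomposition»: «each
`Aᵣ` is indecomposable and non-zero» — Mathlib's `Indecomposable` includes `¬ IsZero`).  For abelian `C` the hypothesis
`[HasFiniteBiproducts C]` is carried explicitly (Mathlib keeps `Abelian.hasFiniteBiproducts` a non-instance theorem).

## The sources, verbatim

Atiyah [Atiyah1956, §4]: «DEFINITION. The maps `iᵣ : Aᵣ → A`, `pᵣ : A → Aᵣ` (`r = 1, …, n`) give a *direct decomposition* of `A`, written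
`A = A₁ ⊕ A₂ ⊕ … ⊕ Aₙ`, if (i) `pᵣ iᵣ = e_{Aᵣ}`, `pᵣ iₛ = 0` (`r ≠ s`), (ii) `∑ᵣ iᵣ pᵣ = e_A`. If for some `r`, `iᵣ` (and hence also `pᵣ`) is an
equivalence, the decomposition is *trivial*; in this case the remaining maps `iₛ` and `pₛ` (`r ≠ s`) are necessarily zero. … DEFINITION. `A`
is *indecomposable* if every direct decomposition of `A` is trivial.  DEFINITION. `A = A₁ ⊕ … ⊕ Aₙ` is a *Remak decomposition* of `A` if each
`Aᵣ` is indecomposable and non-zero.  LEMMA 4. If the bi-chain condition holds in `𝔄`, then every non-zero `A ∈ 𝔄` has a Remak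
decomposition.  *Proof.* Suppose that `A` is non-zero and has no Remak decomposition. Then `A` must have a non-trivial decomposition
`A = A₁ ⊕ B₁` where at least one of the factors, say `A₁`, has no Remak decomposition. Repeating this process we obtain at the `n`-th stage
`Aₙ₋₁ = Aₙ ⊕ Bₙ`. Put `A₀ = A`, and let `iₙ : Aₙ → Aₙ₋₁`, `pₙ : Aₙ₋₁ → Aₙ` be the maps defining the decompositions. Then `{Aₙ, iₙ, pₙ}` is a
bi-chain of `𝔄` which does not terminate. This is a contradiction, and the lemma is therefore proved.»  «THEOREM 1. Let `𝔄` be an exact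
category in which the bi-chain condition holds. Then the Krull-Schmidt theorem holds in `𝔄`. More precisely, every non-zero `A ∈ 𝔄` has a
Remak decomposition, and if `A = A₁ ⊕ ⋯ ⊕ Aₙ`, `A = A′₁ ⊕ ⋯ ⊕ A′ₘ` are two Remak decompositions of `A`, then `m = n` and after re-ordering
the suffixes `Aᵢ ≅ A′ᵢ`.»
Krause [Krause2015KS, §5]: **Theorem 5.5 (Atiyah).** «An object satisfying the bi-chain condition admits a decomposition into a finite
direct sum of indecomposable objects having local endomorphism rings.  *Proof.* Fix an object `X` satisfying the bi-chain condition.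
Assume that `X` has no decomposition into a finite direct sum of indecomposable objects. Then there is a decomposition `X = X₁ ⊕ Y₁` such
that `X₁` has no decomposition into a finite direct sum of indecomposable objects and `Y₁ ≠ 0`. We continue decomposing `X₁` and obtain a
bi-chain `Xₙ —αₙ→ Xₙ₊₁ —βₙ→ Xₙ` (`n ≥ 0`) with `X = X₀` and `αₙβₙ = id_{Xₙ₊₁}` for all `n ≥ 0`. This bi-chain does not terminate and this is
a contradiction. It remains to observe that any direct summand of `X` satisfies the bi-chain condition. In particular, every indecomposable
direct summand has a local endomorphism ring by Proposition 5.4.»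

## What is formalised

* §1 (preadditive, finite + binary biproducts) closure of «has a finite decomposition into indecomposables»: zero objects (`Fin 0`),
  indecomposables (`Fin 1`), binary biproducts of two decomposable objects (concatenation over `Fin n ⊕ Fin m ≃ Fin (n+m)`, tree lemma
  `nonempty_iso_biproduct_sum_elim_of_iso_biprod` + `biproduct.reindex`); `isZero_of_isIso_comp_fst` (trivial decompositions); the
  DECOMPOSITION STEP `exists_retract_not_isIso_of_not_exists_iso_biproduct_indecomposable`: an object without a finite decomposition has a
  retract `Y —π→ Y′ —ι→ Y`, `ι ≫ π = 𝟙`, with `π` not invertible and `Y′` again without one.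
* §2 **Atiyah's Lemma 4 ∕ existence half of Krause's Thm. 5.5** `BichainCondition.exists_iso_biproduct_indecomposable` (any preadditive
  category with finite biproducts): a bi-chain object is a finite biproduct of indecomposables — iterating the step (`choose` + `Nat.rec`)
  gives a bi-chain of split epis ∕ split monos through `X` that never terminates; `exists_iso_biproduct_isLocalRing_end_of` (local
  endomorphism rings granted Prop. 5.4 for the category at hand).
* §3 (abelian) **Krause's Theorem 5.5** `BichainCondition.exists_iso_biproduct_indecomposable_isLocalRing_end` (summands indecomposable
  WITH local endomorphism rings — they inherit the bi-chain condition, g41-#1, and g41-#3's Prop. 5.4 applies),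
  `exists_iso_biproduct_isLocalRing_end`, `isLocalRing_end_of_iso_biproduct_of_indecomposable` (in ANY decomposition into indecomposables
  the summands are local); **Atiyah's Theorem 1** `BichainCondition.krullRemakSchmidt` (existence, and uniqueness among all finite
  decompositions into indecomposables: `r = s` and `Ys j ≅ Zs (σ j)`, through the tree's `krullRemakSchmidt_of_iso_biproduct_isLocalRing_end`)
  and `exists_equiv_iso_of_iso_biproduct_of_indecomposable` (arbitrary finite index types).
* §4 **objects of FINITE LENGTH** (artinian and noetherian; g41-#2 Lemma 5.1): Remak decomposition with local summands, the Krull–Schmidt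
  theorem, indecomposable ⟺ local `End`, Fitting's lemma, iso-or-nilpotent — `…_of_isArtinianObject_of_isNoetherianObject`; and
  **Atiyah's Theorem 1 for a category with both chain conditions** (`Artinian C`, `Noetherian C`): every object is a finite biproduct of
  objects with local endomorphism rings (`forall_exists_iso_biproduct_isLocalRing_end_of_artinian_of_noetherian`) — i.e. such an abelian
  category is a Krull–Schmidt category in the sense of the tree's `forall_exists_iso_biproduct_isLocalRing_end_iff` (Krause Cor. 4.4).

* §5 (appended, g41-#6) **Atiyah's own route «finite-dimensional `Hom` ⟹ bi-chain ⟹ Krull–Schmidt»** for `k`-linear abelian categories: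
  an object with ARTINIAN endomorphism module (g41-#1 `bichainCondition_of_isArtinian_end`) has a Remak decomposition with local summands
  (`exists_iso_biproduct_indecomposable_isLocalRing_end_of_isArtinian_end`), Krull–Remak–Schmidt uniqueness (`krullRemakSchmidt_of_isArtinian_end`,
  `krullRemakSchmidt_of_finite_end` for finite-dimensional `Hom(X,X)` over a division ring), **Fitting's lemma**
  (`exists_iso_biprod_image_kernel_pow_of_isArtinian_end`) and indecomposable ⟺ local ∕ iso-or-nilpotent
  (`indecomposable_iff_isLocalRing_end_of_isArtinian_end`).
* §6 (appended, g41-#6) **cancellation**: bi-chain objects cancel from biproducts (`BichainCondition.nonempty_iso_of_biprod_iso_biprod`: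
  `A ⊞ B ≅ A ⊞ B′ ⟹ B ≅ B′`), power cancellation (`nonempty_iso_of_biproduct_const_iso`: `X^{⊕α} ≅ Y^{⊕α} ⟹ X ≅ Y`), the multiplicity
  criterion `nonempty_iso_iff_forall_natCard_eq`, and the finite-length forms — through the tree's `KrullSchmidtObjects` (Evans ∕ Krause 4.2–4.4).

NOT here: Atiyah's §5 application to coherent sheaves on complete varieties (needs the `Hom`-finiteness of `Coh X`, i.e. g41-#1's
`bichainCondition_of_finite_end` plus Serre's finiteness theorem) and Krause's Cor. 4.4 ⟸ packaging as a `KrullSchmidt` class (the tree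
spells the property out).

## Mathlib ∕ Literature search

Mathlib: `Indecomposable`, `biproductUniqueIso`, `biproduct.reindex`, `finSumFinEquiv`, `biproduct.total`, `biprod.braiding`,
`IsZero.iso`∕`iff_id_eq_zero`, `IsSplitEpi.mk'`∕`IsSplitMono.mk'`, `Artinian C`∕`Noetherian C`; Mathlib has no Krull–Schmidt theorem for
categories (`rg -il "krull.schmidt|remak" Mathlib/CategoryTheory` → nothing).  Literature REUSED: g41-#1∕#2∕#3 (`BichainCondition`,
`of_iso_biproduct`, `bichainCondition_of_isArtinianObject_of_isNoetherianObject`, `isLocalRing_end`, `indecomposable_iff_isLocalRing_end`,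
`exists_iso_biprod_image_kernel_pow`, `isIso_or_isNilpotent`), `Preadditive/KrullSchmidtSummands` (`nonempty_iso_biproduct_sum_elim_of_iso_biprod`),
`Preadditive/KrullSchmidtObjects` (`krullRemakSchmidt_of_iso_biproduct_isLocalRing_end`, `nonempty_iso_of_biprod_iso_biprod_of_iso_biproduct_isLocalRing_end`,
`nonempty_iso_of_biproduct_const_iso_of_iso_biproduct_isLocalRing_end`, `nonempty_iso_iff_forall_natCard_eq'`), `Preadditive/KrullSchmidtUniqueness`
(`exists_equiv_iso_of_iso_biproduct`, Krause Thm. 4.2).  The tree's earlier existence theorems (`KrullSchmidtDecompositionExistence`,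
`KrullSchmidtSemiperfect`: ARTINIAN or SEMIPERFECT endomorphism ring) are a different route; this file is the chain-condition route of
Atiyah, which covers objects of finite length without any hypothesis on `End X`.

## References

* M. Atiyah, *On the Krull-Schmidt theorem with application to sheaves*, Bull. Soc. Math. France 84 (1956) 307–317: §4 Definitions,
  Lemma 4, Theorem 1. [Atiyah1956]
* H. Krause, *Krull–Schmidt categories and projective covers*, Expo. Math. 33 (2015) 535–549, arXiv:1410.2822: §5 Thm. 5.5 (with Lemma 5.1,
  Prop. 5.4), Thm. 4.2. [Krause2015KS]

## Provenance

Lane `lit-hodgefound` (summit `HodgeConjecture`, Track 2 foundations library), seat `lit-hodgefound-p36` (literature-prover, generation 41,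
row g41-#4; §§5–6 appended as row g41-#6); Krause materialised as `paper-arxiv-1410.2822` (p0010), Atiyah as `galaxy-pdf-4113901900` (scan pp. 4–6 = pp. 310–312).
-/

open CategoryTheory CategoryTheory.Limits

namespace Literature.CategoryTheory.KrullSchmidt

universe v u

variable {C : Type u} [Category.{v} C]

/-! ## §1 Finite decompositions into indecomposables: closure properties -/

section Preadditive

variable [Preadditive C] [HasFiniteBiproducts C] [HasBinaryBiproducts C]

omit [HasBinaryBiproducts C] in
/-- A biproduct over `Fin 0` is a zero object. [cite: Atiyah1956, §4 Definition (direct decomposition)] -/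
theorem isZero_biproduct_fin_zero (Z : Fin 0 → C) : IsZero (⨁ Z) := by
  rw [IsZero.iff_id_eq_zero, ← biproduct.total]
  simp

/-- A zero object has the empty Remak decomposition. [cite: Atiyah1956, §4 Lemma 4] -/
theorem exists_iso_biproduct_indecomposable_of_isZero {Y : C} (hY : IsZero Y) :
    ∃ (n : ℕ) (Z : Fin n → C), Nonempty (Y ≅ ⨁ Z) ∧ ∀ j, Indecomposable (Z j) :=
  ⟨0, fun j => Fin.elim0 j, ⟨hY.iso (isZero_biproduct_fin_zero _)⟩, fun j => Fin.elim0 j⟩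

/-- An indecomposable object is its own Remak decomposition. [cite: Atiyah1956, §4 Lemma 4] -/
theorem exists_iso_biproduct_indecomposable_of_indecomposable {Y : C} (hY : Indecomposable Y) :
    ∃ (n : ℕ) (Z : Fin n → C), Nonempty (Y ≅ ⨁ Z) ∧ ∀ j, Indecomposable (Z j) :=
  ⟨1, fun _ => Y, ⟨(biproductUniqueIso (fun _ : Fin 1 => Y)).symm⟩, fun _ => hY⟩

/-- Remak decompositions of the two summands of `Y ≅ Y₁ ⊞ Y₂` concatenate to one of `Y` (Atiyah: «if `A = A₁ ⊕ A₂ ⊕ … ⊕ Aₙ`, then …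
`B = A₂ ⊕ … ⊕ Aₙ`»). [cite: Atiyah1956, §4 Definition (direct decomposition)] -/
theorem exists_iso_biproduct_indecomposable_of_iso_biprod {Y Y₁ Y₂ : C} (i : Y ≅ Y₁ ⊞ Y₂)
    (h₁ : ∃ (n : ℕ) (Z : Fin n → C), Nonempty (Y₁ ≅ ⨁ Z) ∧ ∀ j, Indecomposable (Z j))
    (h₂ : ∃ (n : ℕ) (Z : Fin n → C), Nonempty (Y₂ ≅ ⨁ Z) ∧ ∀ j, Indecomposable (Z j)) :
    ∃ (n : ℕ) (Z : Fin n → C), Nonempty (Y ≅ ⨁ Z) ∧ ∀ j, Indecomposable (Z j) := by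
  obtain ⟨n, Z₁, ⟨i₁⟩, hZ₁⟩ := h₁
  obtain ⟨m, Z₂, ⟨i₂⟩, hZ₂⟩ := h₂
  obtain ⟨e⟩ := nonempty_iso_biproduct_sum_elim_of_iso_biprod i i₁ i₂
  refine ⟨n + m, fun j => Sum.elim Z₁ Z₂ (finSumFinEquiv.symm j),
    ⟨e ≪≫ (biproduct.reindex finSumFinEquiv.symm (fun s : Fin n ⊕ Fin m => Sum.elim Z₁ Z₂ s)).symm⟩, fun j => ?_⟩
  dsimp only
  generalize finSumFinEquiv.symm j = s
  cases s with
  | inl a => exact hZ₁ a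
  | inr b => exact hZ₂ b

omit [HasFiniteBiproducts C] in
/-- If the first projection of `Y ≅ Y₁ ⊞ Y₂` is an isomorphism, the second summand is zero (Atiyah: «If for some `r`, `iᵣ` (and hence also
`pᵣ`) is an equivalence, the decomposition is *trivial*; in this case the remaining maps `iₛ` and `pₛ` (`r ≠ s`) are necessarily zero»).
[cite: Atiyah1956, §4 Definition (trivial decomposition)] -/
theorem isZero_of_isIso_comp_fst {Y Y₁ Y₂ : C} (i : Y ≅ Y₁ ⊞ Y₂) [IsIso (i.hom ≫ biprod.fst)] : IsZero Y₂ := by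
  haveI : IsIso (biprod.fst : Y₁ ⊞ Y₂ ⟶ Y₁) := by
    have : (biprod.fst : Y₁ ⊞ Y₂ ⟶ Y₁) = i.inv ≫ (i.hom ≫ biprod.fst) := by simp
    rw [this]
    infer_instance
  rw [IsZero.iff_id_eq_zero, ← biprod.inr_snd]
  have h : (biprod.inr : Y₂ ⟶ Y₁ ⊞ Y₂) = 0 := by
    rw [← cancel_mono (biprod.fst : Y₁ ⊞ Y₂ ⟶ Y₁), biprod.inr_fst, zero_comp]
  rw [h, zero_comp]

/-- The decomposition step of Atiyah's Lemma 4 ∕ Krause's Thm. 5.5: an object WITHOUT a finite decomposition into indecomposables splits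
off a proper direct summand without one («`A` must have a non-trivial decomposition `A = A₁ ⊕ B₁` where at least one of the factors, say
`A₁`, has no Remak decomposition»): there are `π : Y ⟶ Y'`, `ι : Y' ⟶ Y` with `ι ≫ π = 𝟙`, `π` NOT an isomorphism, and `Y'` again
without a finite decomposition. [cite: Atiyah1956, §4 Lemma 4 (proof)] [cite: Krause2015KS, §5 Thm. 5.5 (proof)] -/
theorem exists_retract_not_isIso_of_not_exists_iso_biproduct_indecomposable {Y : C}
    (hY : ¬ ∃ (n : ℕ) (Z : Fin n → C), Nonempty (Y ≅ ⨁ Z) ∧ ∀ j, Indecomposable (Z j)) :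
    ∃ (Y' : C) (π : Y ⟶ Y') (ι : Y' ⟶ Y), ι ≫ π = 𝟙 Y' ∧ ¬ IsIso π ∧
      ¬ ∃ (n : ℕ) (Z : Fin n → C), Nonempty (Y' ≅ ⨁ Z) ∧ ∀ j, Indecomposable (Z j) := by
  have h0 : ¬ IsZero Y := fun h => hY (exists_iso_biproduct_indecomposable_of_isZero h)
  have hind : ¬ Indecomposable Y := fun h => hY (exists_iso_biproduct_indecomposable_of_indecomposable h)
  have hsplit : ∃ (Y₁ Y₂ : C), Nonempty (Y ≅ Y₁ ⊞ Y₂) ∧ ¬ IsZero Y₁ ∧ ¬ IsZero Y₂ := by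
    by_contra hc
    apply hind
    refine ⟨h0, fun Y₁ Y₂ i => ?_⟩
    by_contra hc'
    rw [not_or] at hc'
    exact hc ⟨Y₁, Y₂, ⟨i⟩, hc'.1, hc'.2⟩
  obtain ⟨Y₁, Y₂, ⟨i⟩, h₁, h₂⟩ := hsplit
  by_cases hY₁ : ∃ (n : ℕ) (Z : Fin n → C), Nonempty (Y₁ ≅ ⨁ Z) ∧ ∀ j, Indecomposable (Z j)
  · -- then `Y₂` has no finite decomposition: split it off through the braiding
    have hY₂ : ¬ ∃ (n : ℕ) (Z : Fin n → C), Nonempty (Y₂ ≅ ⨁ Z) ∧ ∀ j, Indecomposable (Z j) :=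
      fun hY₂ => hY (exists_iso_biproduct_indecomposable_of_iso_biprod i hY₁ hY₂)
    let i' : Y ≅ Y₂ ⊞ Y₁ := i ≪≫ biprod.braiding Y₁ Y₂
    refine ⟨Y₂, i'.hom ≫ biprod.fst, biprod.inl ≫ i'.inv, by simp, fun hiso => h₁ (isZero_of_isIso_comp_fst i'), hY₂⟩
  · refine ⟨Y₁, i.hom ≫ biprod.fst, biprod.inl ≫ i.inv, by simp, fun hiso => h₂ (isZero_of_isIso_comp_fst i), hY₁⟩

/-! ## §2 Atiyah's Lemma 4 ∕ Krause's Thm. 5.5: bi-chain objects have Remak decompositions -/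

/-- **Atiyah's Lemma 4 ∕ the existence half of Krause's Theorem 5.5**, in any preadditive category with finite biproducts: «If the
bi-chain condition holds in `𝔄`, then every non-zero `A ∈ 𝔄` has a Remak decomposition» — an object satisfying the bi-chain condition is
a finite biproduct of indecomposable objects.  Proof as printed: otherwise split off, again and again, a proper summand without a finite
decomposition (§1); the projections and inclusions form a bi-chain `Aₙ₋₁ —pₙ→ Aₙ —iₙ→ Aₙ₋₁` with `iₙ pₙ`-retractions which never
terminates («This bi-chain does not terminate and this is a contradiction»). [cite: Atiyah1956, §4 Lemma 4] [cite: Krause2015KS, §5 Thm. 5.5] -/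
theorem BichainCondition.exists_iso_biproduct_indecomposable {X : C} (hX : BichainCondition X) :
    ∃ (n : ℕ) (Z : Fin n → C), Nonempty (X ≅ ⨁ Z) ∧ ∀ j, Indecomposable (Z j) := by
  by_contra hX'
  -- the type of objects without a finite decomposition, and a choice of splitting for each
  let T := {Y : C // ¬ ∃ (n : ℕ) (Z : Fin n → C), Nonempty (Y ≅ ⨁ Z) ∧ ∀ j, Indecomposable (Z j)}
  have step : ∀ s : T, ∃ t : T, ∃ (π : s.1 ⟶ t.1) (ι : t.1 ⟶ s.1), ι ≫ π = 𝟙 _ ∧ ¬ IsIso π := by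
    intro s
    obtain ⟨Y', π, ι, hιπ, hπ, hY'⟩ := exists_retract_not_isIso_of_not_exists_iso_biproduct_indecomposable s.2
    exact ⟨⟨Y', hY'⟩, π, ι, hιπ, hπ⟩
  choose next π ι hιπ hπ using step
  let S : ℕ → T := fun n => Nat.rec ⟨X, hX'⟩ (fun _ s => next s) n
  have hS : ∀ n, S (n + 1) = next (S n) := fun n => rfl
  let B : Bichain C :=
    { obj := fun n => (S n).1
      fwd := fun n => π (S n)
      bwd := fun n => ι (S n)
      epi_fwd := fun n => by
        haveI : IsSplitEpi (π (S n)) := IsSplitEpi.mk' ⟨ι (S n), hιπ (S n)⟩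
        infer_instance
      mono_bwd := fun n => by
        haveI : IsSplitMono (ι (S n)) := IsSplitMono.mk' ⟨π (S n), hιπ (S n)⟩
        infer_instance }
  obtain ⟨n₀, hn₀⟩ := hX B ⟨Iso.refl X⟩
  exact hπ (S n₀) (hn₀ n₀ le_rfl).1

/-- Krause's Theorem 5.5 adds: «having local endomorphism rings» — granted that the indecomposable bi-chain objects of `C` have local
endomorphism rings (e.g. `C` abelian, §3), since the summands inherit the bi-chain condition (g41-#1 `of_iso_biproduct`).
[cite: Krause2015KS, §5 Thm. 5.5] -/
theorem BichainCondition.exists_iso_biproduct_isLocalRing_end_of {X : C} (hX : BichainCondition X)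
    (hloc : ∀ Y : C, BichainCondition Y → Indecomposable Y → IsLocalRing (End Y)) :
    ∃ (n : ℕ) (Z : Fin n → C), Nonempty (X ≅ ⨁ Z) ∧ ∀ j, Indecomposable (Z j) ∧ IsLocalRing (End (Z j)) := by
  obtain ⟨n, Z, ⟨i⟩, hZ⟩ := hX.exists_iso_biproduct_indecomposable
  exact ⟨n, Z, ⟨i⟩, fun j => ⟨hZ j, hloc _ (hX.of_iso_biproduct i j) (hZ j)⟩⟩

end Preadditive

/-! ## §3 Abelian categories: Krause's Theorem 5.5 and Atiyah's Theorem 1 -/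

section Abelian

variable [Abelian C] [HasFiniteBiproducts C] {X : C}

/-- **Krause's Theorem 5.5 (Atiyah).** «An object satisfying the bi-chain condition admits a decomposition into a finite direct sum of
indecomposable objects having local endomorphism rings» (abelian category; the summands satisfy the bi-chain condition and Prop. 5.4 —
g41-#3 `BichainCondition.isLocalRing_end` — applies). [cite: Krause2015KS, §5 Thm. 5.5] [cite: Atiyah1956, §4 Lemma 4] -/
theorem BichainCondition.exists_iso_biproduct_indecomposable_isLocalRing_end (hX : BichainCondition X) :
    ∃ (n : ℕ) (Z : Fin n → C), Nonempty (X ≅ ⨁ Z) ∧ ∀ j, Indecomposable (Z j) ∧ IsLocalRing (End (Z j)) :=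
  hX.exists_iso_biproduct_isLocalRing_end_of fun _ hY hind => hY.isLocalRing_end hind

/-- The local-endomorphism-ring form alone (the shape used by the tree's Krull–Schmidt files, e.g. `krullRemakSchmidt_of_iso_biproduct_isLocalRing_end`).
[cite: Krause2015KS, §5 Thm. 5.5] -/
theorem BichainCondition.exists_iso_biproduct_isLocalRing_end (hX : BichainCondition X) :
    ∃ (n : ℕ) (Z : Fin n → C), Nonempty (X ≅ ⨁ Z) ∧ ∀ j, IsLocalRing (End (Z j)) := by
  obtain ⟨n, Z, hi, hZ⟩ := hX.exists_iso_biproduct_indecomposable_isLocalRing_end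
  exact ⟨n, Z, hi, fun j => (hZ j).2⟩

/-- In ANY finite biproduct decomposition of a bi-chain object into indecomposables, the summands have local endomorphism rings (they are
bi-chain objects). [cite: Krause2015KS, §5 Thm. 5.5 (proof)] [cite: Krause2015KS, §5 Prop. 5.4] -/
theorem BichainCondition.isLocalRing_end_of_iso_biproduct_of_indecomposable (hX : BichainCondition X) {ι : Type} [Finite ι]
    {Z : ι → C} (i : X ≅ ⨁ Z) (hZ : ∀ j, Indecomposable (Z j)) (j : ι) : IsLocalRing (End (Z j)) :=
  (hX.of_iso_biproduct i j).isLocalRing_end (hZ j)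

/-- **Atiyah's Theorem 1 (the Krull–Schmidt theorem), object-wise**: «every non-zero `A ∈ 𝔄` has a Remak decomposition, and if
`A = A₁ ⊕ ⋯ ⊕ Aₙ`, `A = A′₁ ⊕ ⋯ ⊕ A′ₘ` are two Remak decompositions of `A`, then `m = n` and after re-ordering the suffixes `Aᵢ ≅ A′ᵢ`» —
for an object satisfying the bi-chain condition in an abelian category.  Existence is §2; uniqueness is the tree's Krull–Remak–Schmidt
uniqueness for objects with a local-`End` decomposition (`krullRemakSchmidt_of_iso_biproduct_isLocalRing_end`, Krause Thm. 4.2; abelian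
categories are idempotent complete). [cite: Atiyah1956, §4 Theorem 1] [cite: Krause2015KS, §5 Thm. 5.5] -/
theorem BichainCondition.krullRemakSchmidt (hX : BichainCondition X) :
    (∃ (n : ℕ) (Z : Fin n → C), Nonempty (X ≅ ⨁ Z) ∧ ∀ j, Indecomposable (Z j)) ∧
      ∀ {r s : ℕ} {Ys : Fin r → C} {Zs : Fin s → C}, Nonempty (X ≅ ⨁ Ys) → Nonempty (X ≅ ⨁ Zs) →
        (∀ j, Indecomposable (Ys j)) → (∀ k, Indecomposable (Zs k)) →
          r = s ∧ ∃ σ : Fin r ≃ Fin s, ∀ j, Nonempty (Ys j ≅ Zs (σ j)) := by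
  obtain ⟨n, Z, ⟨i⟩, hZ⟩ := hX.exists_iso_biproduct_indecomposable_isLocalRing_end
  exact ⟨⟨n, Z, ⟨i⟩, fun j => (hZ j).1⟩, krullRemakSchmidt_of_iso_biproduct_isLocalRing_end _ i fun j => (hZ j).2⟩

/-- Uniqueness with arbitrary finite index types: two decompositions of a bi-chain object into indecomposables differ by a bijection of the
index sets and isomorphisms of the summands. [cite: Atiyah1956, §4 Theorem 1] [cite: Krause2015KS, Thm. 4.2] -/
theorem BichainCondition.exists_equiv_iso_of_iso_biproduct_of_indecomposable (hX : BichainCondition X) {ι κ : Type} [Fintype ι]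
    [Fintype κ] [DecidableEq ι] [DecidableEq κ] {Ys : ι → C} {Zs : κ → C} (i₁ : X ≅ ⨁ Ys) (i₂ : X ≅ ⨁ Zs)
    (h₁ : ∀ j, Indecomposable (Ys j)) (h₂ : ∀ k, Indecomposable (Zs k)) : ∃ σ : ι ≃ κ, ∀ j, Nonempty (Ys j ≅ Zs (σ j)) :=
  exists_equiv_iso_of_iso_biproduct i₁ i₂ (fun j => hX.isLocalRing_end_of_iso_biproduct_of_indecomposable i₁ h₁ j)
    fun k => hX.isLocalRing_end_of_iso_biproduct_of_indecomposable i₂ h₂ k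

/-! ## §4 Objects of finite length; abelian categories with chain conditions are Krull–Schmidt categories -/

/-- **The Krull–Schmidt theorem for objects of finite length** (artinian and noetherian) of an abelian category: existence of a Remak
decomposition with local endomorphism rings … [cite: Atiyah1956, §4 Theorem 1] [cite: Krause2015KS, §5 Lemma 5.1, Thm. 5.5] -/
theorem exists_iso_biproduct_indecomposable_isLocalRing_end_of_isArtinianObject_of_isNoetherianObject (X : C) [IsArtinianObject X]
    [IsNoetherianObject X] :
    ∃ (n : ℕ) (Z : Fin n → C), Nonempty (X ≅ ⨁ Z) ∧ ∀ j, Indecomposable (Z j) ∧ IsLocalRing (End (Z j)) :=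
  (bichainCondition_of_isArtinianObject_of_isNoetherianObject X).exists_iso_biproduct_indecomposable_isLocalRing_end

/-- … and uniqueness: Atiyah's Theorem 1 for objects of finite length. [cite: Atiyah1956, §4 Theorem 1] [cite: Krause2015KS, §5 Thm. 5.5] -/
theorem krullRemakSchmidt_of_isArtinianObject_of_isNoetherianObject (X : C) [IsArtinianObject X] [IsNoetherianObject X] :
    (∃ (n : ℕ) (Z : Fin n → C), Nonempty (X ≅ ⨁ Z) ∧ ∀ j, Indecomposable (Z j)) ∧
      ∀ {r s : ℕ} {Ys : Fin r → C} {Zs : Fin s → C}, Nonempty (X ≅ ⨁ Ys) → Nonempty (X ≅ ⨁ Zs) →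
        (∀ j, Indecomposable (Ys j)) → (∀ k, Indecomposable (Zs k)) →
          r = s ∧ ∃ σ : Fin r ≃ Fin s, ∀ j, Nonempty (Ys j ≅ Zs (σ j)) :=
  (bichainCondition_of_isArtinianObject_of_isNoetherianObject X).krullRemakSchmidt

omit [HasFiniteBiproducts C] in
/-- For objects of finite length: indecomposable ⟺ local endomorphism ring (Krause Prop. 5.4 with Lemma 5.1). [cite: Krause2015KS, §5 Prop. 5.4]
[cite: Krause2015KS, §5 Lemma 5.1] -/
theorem indecomposable_iff_isLocalRing_end_of_isArtinianObject_of_isNoetherianObject (X : C) [IsArtinianObject X]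
    [IsNoetherianObject X] : Indecomposable X ↔ IsLocalRing (End X) :=
  (bichainCondition_of_isArtinianObject_of_isNoetherianObject X).indecomposable_iff_isLocalRing_end

omit [HasFiniteBiproducts C] in
/-- Fitting's lemma for objects of finite length (Krause 5.3 with 5.1): for every endomorphism `φ`, `X ≅ Im φʳ ⊞ Ker φʳ` through the
canonical monomorphisms for all large `r`. [cite: Krause2015KS, §5 Lemma 5.3 (1)] [cite: Krause2015KS, §5 Lemma 5.1] -/
theorem exists_iso_biprod_image_kernel_pow_of_isArtinianObject_of_isNoetherianObject (X : C) [IsArtinianObject X]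
    [IsNoetherianObject X] (φ : End X) :
    ∃ r₀ : ℕ, ∀ r, r₀ ≤ r → ∃ i : X ≅ Abelian.image (End.asHom (φ ^ r)) ⊞ kernel (End.asHom (φ ^ r)),
      biprod.inl ≫ i.inv = Abelian.image.ι (End.asHom (φ ^ r)) ∧ biprod.inr ≫ i.inv = kernel.ι (End.asHom (φ ^ r)) :=
  (bichainCondition_of_isArtinianObject_of_isNoetherianObject X).exists_iso_biprod_image_kernel_pow φ

omit [HasFiniteBiproducts C] in
/-- An indecomposable object of finite length: every endomorphism is an isomorphism or nilpotent (Atiyah Lemma 6, Krause 5.3 (2) with 5.1).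
[cite: Atiyah1956, §4 Lemma 6] [cite: Krause2015KS, §5 Lemma 5.3 (2)] -/
theorem isIso_or_isNilpotent_of_isArtinianObject_of_isNoetherianObject (X : C) [IsArtinianObject X] [IsNoetherianObject X]
    (hind : Indecomposable X) (φ : End X) : IsIso (End.asHom φ) ∨ IsNilpotent φ :=
  (bichainCondition_of_isArtinianObject_of_isNoetherianObject X).isIso_or_isNilpotent hind φ

/-- **Atiyah's Theorem 1 for the category** («Let `𝔄` be an exact category in which the bi-chain condition holds. Then the Krull-Schmidt
theorem holds in `𝔄`»), in the form: an abelian category whose objects are artinian and noetherian (Mathlib `Artinian C`, `Noetherian C`)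
is a Krull–Schmidt category — every object is a finite biproduct of objects with local endomorphism rings (the characterisation used by the
tree's `forall_exists_iso_biproduct_isLocalRing_end_iff`, Krause Cor. 4.4). [cite: Atiyah1956, §4 Theorem 1] [cite: Krause2015KS, §5 Thm. 5.5] -/
theorem forall_exists_iso_biproduct_isLocalRing_end_of_artinian_of_noetherian [Artinian C] [Noetherian C] (X : C) :
    ∃ (n : ℕ) (Z : Fin n → C), Nonempty (X ≅ ⨁ Z) ∧ ∀ j, IsLocalRing (End (Z j)) :=
  (bichainCondition_of_artinian_of_noetherian X).exists_iso_biproduct_isLocalRing_end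

/-! ## §5 Atiyah's route for `Hom`-finite categories: finite-dimensional `Hom(X,X)` ⟹ bi-chain condition ⟹ Krull–Schmidt -/

section HomFinite

universe w

variable {k : Type w} [Semiring k] [Linear k C]

/-- **Atiyah's Corollary + Theorem 1** (his route to the Krull–Schmidt theorem for coherent sheaves: «Let `𝔄` be an exact category with
… `H(A,B)` a finite-dimensional vector space over a field `k` … Then the bi-chain condition holds in `𝔄`», hence Theorem 1 applies): in a
`k`-linear abelian category, an object whose endomorphism module is an artinian `k`-module is a finite biproduct of indecomposables with
local endomorphism rings (g41-#1 `bichainCondition_of_isArtinian_end` + §3). [cite: Atiyah1956, §3 Corollary, §4 Theorem 1]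
[cite: Krause2015KS, §5 Lemma 5.2, Thm. 5.5] -/
theorem exists_iso_biproduct_indecomposable_isLocalRing_end_of_isArtinian_end (X : C) [IsArtinian k (X ⟶ X)] :
    ∃ (n : ℕ) (Z : Fin n → C), Nonempty (X ≅ ⨁ Z) ∧ ∀ j, Indecomposable (Z j) ∧ IsLocalRing (End (Z j)) :=
  (bichainCondition_of_isArtinian_end (k := k) X).exists_iso_biproduct_indecomposable_isLocalRing_end

/-- … with Krull–Remak–Schmidt uniqueness (Atiyah's Theorem 1 for `Hom`-artinian objects). [cite: Atiyah1956, §3 Corollary, §4 Theorem 1]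
[cite: Krause2015KS, §5 Lemma 5.2, Thm. 5.5] -/
theorem krullRemakSchmidt_of_isArtinian_end (X : C) [IsArtinian k (X ⟶ X)] :
    (∃ (n : ℕ) (Z : Fin n → C), Nonempty (X ≅ ⨁ Z) ∧ ∀ j, Indecomposable (Z j)) ∧
      ∀ {r s : ℕ} {Ys : Fin r → C} {Zs : Fin s → C}, Nonempty (X ≅ ⨁ Ys) → Nonempty (X ≅ ⨁ Zs) →
        (∀ j, Indecomposable (Ys j)) → (∀ k, Indecomposable (Zs k)) →
          r = s ∧ ∃ σ : Fin r ≃ Fin s, ∀ j, Nonempty (Ys j ≅ Zs (σ j)) :=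
  (bichainCondition_of_isArtinian_end (k := k) X).krullRemakSchmidt

omit [HasFiniteBiproducts C] in
/-- **Fitting's lemma for `Hom`-artinian objects of a `k`-linear abelian category** (e.g. finite-dimensional `Hom(X,X)`): `X ≅ Im φʳ ⊞ Ker φʳ`
through the canonical monomorphisms for all large `r` (Krause 5.2 + 5.3). [cite: Krause2015KS, §5 Lemma 5.2, Lemma 5.3 (1)]
[cite: Atiyah1956, §3 Corollary, §4 Lemma 5] -/
theorem exists_iso_biprod_image_kernel_pow_of_isArtinian_end (X : C) [IsArtinian k (X ⟶ X)] (φ : End X) :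
    ∃ r₀ : ℕ, ∀ r, r₀ ≤ r → ∃ i : X ≅ Abelian.image (End.asHom (φ ^ r)) ⊞ kernel (End.asHom (φ ^ r)),
      biprod.inl ≫ i.inv = Abelian.image.ι (End.asHom (φ ^ r)) ∧ biprod.inr ≫ i.inv = kernel.ι (End.asHom (φ ^ r)) :=
  (bichainCondition_of_isArtinian_end (k := k) X).exists_iso_biprod_image_kernel_pow φ

omit [HasFiniteBiproducts C] in
/-- For `Hom`-artinian objects of a `k`-linear abelian category: indecomposable ⟺ local endomorphism ring, and then every endomorphism
is an isomorphism or nilpotent (Krause 5.2 + 5.4 ∕ 5.3 (2); Atiyah Corollary + Lemmas 6–7). [cite: Krause2015KS, §5 Lemma 5.2, Prop. 5.4]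
[cite: Atiyah1956, §3 Corollary, §4 Lemma 6] -/
theorem indecomposable_iff_isLocalRing_end_of_isArtinian_end (X : C) [IsArtinian k (X ⟶ X)] :
    (Indecomposable X ↔ IsLocalRing (End X)) ∧
      (Indecomposable X → ∀ φ : End X, IsIso (End.asHom φ) ∨ IsNilpotent φ) :=
  ⟨(bichainCondition_of_isArtinian_end (k := k) X).indecomposable_iff_isLocalRing_end,
    fun hind φ => (bichainCondition_of_isArtinian_end (k := k) X).isIso_or_isNilpotent hind φ⟩

/-- Atiyah's hypothesis verbatim — finite-dimensional `Hom(X,X)` over a division ring: Remak decomposition with local endomorphism rings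
and Krull–Remak–Schmidt uniqueness. [cite: Atiyah1956, §3 Corollary, §4 Theorem 1] -/
theorem krullRemakSchmidt_of_finite_end {K : Type w} [DivisionRing K] [Linear K C] (X : C) [Module.Finite K (X ⟶ X)] :
    (∃ (n : ℕ) (Z : Fin n → C), Nonempty (X ≅ ⨁ Z) ∧ ∀ j, Indecomposable (Z j) ∧ IsLocalRing (End (Z j))) ∧
      ∀ {r s : ℕ} {Ys : Fin r → C} {Zs : Fin s → C}, Nonempty (X ≅ ⨁ Ys) → Nonempty (X ≅ ⨁ Zs) →
        (∀ j, Indecomposable (Ys j)) → (∀ k, Indecomposable (Zs k)) →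
          r = s ∧ ∃ σ : Fin r ≃ Fin s, ∀ j, Nonempty (Ys j ≅ Zs (σ j)) :=
  ⟨(bichainCondition_of_finite_end (k := K) X).exists_iso_biproduct_indecomposable_isLocalRing_end,
    (bichainCondition_of_finite_end (k := K) X).krullRemakSchmidt.2⟩

end HomFinite

/-! ## §6 Cancellation for bi-chain objects and objects of finite length -/

/-- **Bi-chain objects cancel**: if `A` satisfies the bi-chain condition then `A ⊞ B ≅ A ⊞ B′` implies `B ≅ B′`, for arbitrary `B, B′`
(Theorem 5.5 gives `A` a finite local-`End` decomposition, and such objects cancel — tree lemma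
`nonempty_iso_of_biprod_iso_biprod_of_iso_biproduct_isLocalRing_end`, Evans ∕ Lam (20.11)). [cite: Krause2015KS, §5 Thm. 5.5]
[cite: Krause2015KS, Cor. 4.3] -/
theorem BichainCondition.nonempty_iso_of_biprod_iso_biprod {A B B' : C} (hA : BichainCondition A) (φ : A ⊞ B ≅ A ⊞ B') :
    Nonempty (B ≅ B') := by
  obtain ⟨n, Z, ⟨i⟩, hZ⟩ := hA.exists_iso_biproduct_isLocalRing_end
  exact nonempty_iso_of_biprod_iso_biprod_of_iso_biproduct_isLocalRing_end i hZ φ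

/-- **Power cancellation for bi-chain objects**: `X^{⊕α} ≅ Y^{⊕α}` (`α` finite, non-empty) implies `X ≅ Y` when `X` and `Y` satisfy the
bi-chain condition (tree lemma `nonempty_iso_of_biproduct_const_iso_of_iso_biproduct_isLocalRing_end`, Krause Thm. 4.2).
[cite: Krause2015KS, §5 Thm. 5.5] [cite: Krause2015KS, Thm. 4.2] -/
theorem BichainCondition.nonempty_iso_of_biproduct_const_iso {α : Type} [Finite α] [Nonempty α] {X Y : C} (hX : BichainCondition X)
    (hY : BichainCondition Y) (φ : (⨁ fun _ : α => X) ≅ (⨁ fun _ : α => Y)) : Nonempty (X ≅ Y) := by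
  obtain ⟨n, Xs, ⟨iX⟩, hXs⟩ := hX.exists_iso_biproduct_isLocalRing_end
  obtain ⟨m, Ys, ⟨iY⟩, hYs⟩ := hY.exists_iso_biproduct_isLocalRing_end
  exact nonempty_iso_of_biproduct_const_iso_of_iso_biproduct_isLocalRing_end iX hXs iY hYs φ

/-- **Isomorphism criterion by multiplicities** for bi-chain objects given with decompositions into indecomposables: `X ≅ Y` iff every
indecomposable occurs equally often (Krause Thm. 4.2 as a criterion; the summands are local by §3). [cite: Krause2015KS, Thm. 4.2]
[cite: Atiyah1956, §4 Theorem 1] -/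
theorem BichainCondition.nonempty_iso_iff_forall_natCard_eq {X Y : C} (hX : BichainCondition X) (hY : BichainCondition Y) {ι κ : Type}
    [Fintype ι] [Fintype κ] [DecidableEq ι] [DecidableEq κ] {Xs : ι → C} {Ys : κ → C} (i₁ : X ≅ ⨁ Xs) (i₂ : Y ≅ ⨁ Ys)
    (h₁ : ∀ j, Indecomposable (Xs j)) (h₂ : ∀ k, Indecomposable (Ys k)) :
    Nonempty (X ≅ Y) ↔ ∀ V : C, Nat.card {j // Nonempty (Xs j ≅ V)} = Nat.card {k // Nonempty (Ys k ≅ V)} :=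
  nonempty_iso_iff_forall_natCard_eq' i₁ i₂ (fun j => hX.isLocalRing_end_of_iso_biproduct_of_indecomposable i₁ h₁ j)
    fun k => hY.isLocalRing_end_of_iso_biproduct_of_indecomposable i₂ h₂ k

/-- **Objects of finite length cancel**: `A ⊞ B ≅ A ⊞ B′` with `A` artinian and noetherian implies `B ≅ B′`. [cite: Krause2015KS, §5 Lemma 5.1, Thm. 5.5]
[cite: Atiyah1956, §4 Theorem 1] -/
theorem nonempty_iso_of_biprod_iso_biprod_of_isArtinianObject_of_isNoetherianObject {A B B' : C} [IsArtinianObject A]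
    [IsNoetherianObject A] (φ : A ⊞ B ≅ A ⊞ B') : Nonempty (B ≅ B') :=
  (bichainCondition_of_isArtinianObject_of_isNoetherianObject A).nonempty_iso_of_biprod_iso_biprod φ

/-- **Power cancellation for objects of finite length**: `X^{⊕α} ≅ Y^{⊕α}` (`α` finite, non-empty) implies `X ≅ Y`.
[cite: Krause2015KS, §5 Lemma 5.1, Thm. 5.5] [cite: Krause2015KS, Thm. 4.2] -/
theorem nonempty_iso_of_biproduct_const_iso_of_isArtinianObject_of_isNoetherianObject {α : Type} [Finite α] [Nonempty α] {X Y : C}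
    [IsArtinianObject X] [IsNoetherianObject X] [IsArtinianObject Y] [IsNoetherianObject Y]
    (φ : (⨁ fun _ : α => X) ≅ (⨁ fun _ : α => Y)) : Nonempty (X ≅ Y) :=
  (bichainCondition_of_isArtinianObject_of_isNoetherianObject X).nonempty_iso_of_biproduct_const_iso
    (bichainCondition_of_isArtinianObject_of_isNoetherianObject Y) φ

end Abelian

end Literature.CategoryTheory.KrullSchmidt
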